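import Summits.CriticalPhenomena.PercolationContinuityZ3.Theorems.PercNearOneGluingNoHeavyLowerTailSahiOneStepGoodPivotReduction
import Summits.CriticalPhenomena.PercolationContinuityZ3.Theorems.PercNearOneGluingNoHeavyLowerTailSahiOneStepThresholdsMLR
import HarnessLib

/-!
# One-step scheme: the PIVOT LEMMA — some counted pivot always helps an increasing event inside the ball

Prover prim-ineq-prove-3 gen 27 (`--supports stmt-CriticalPhenomena-4575`; memo
`run/shared/lean/prim/prim-ineq-prove-3/FINDING-G27-PIVOT-CERTIFICATE.md` §0(iv)).  No definitions, no sorries.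

For an increasing `B`, a block `F` with nondegenerate densities and the ball `L = {N_F < t+1}`:
`Σ_{e ∈ F} [μL·μ(B ∩ L ∩ {e ∈ ω}) − μ(B ∩ L)·μ(L ∩ {e ∈ ω})] = μL·Σ_k k μ(B ∩ L ∩ {N_F = k}) − μ(B∩L)·Σ_k k μ(L ∩ {N_F = k}) ≥ 0`
(double counting + layer monotonicity + the MLR comparison `ThreshGrid.mlr_sum_le`), i.e. `Cov_{μ(·∣L)}(1_B, N_F) ≥ 0`; hence SOME `e ∈ F`
has `Cov_{μ(·∣L)}(1_B, x_e) ≥ 0`, which in section form is the first good-pivot condition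
`X̃_B(e) = ℓ⁰μ(B¹ ∩ L¹) − ℓ¹μ(B⁰ ∩ L⁰) ≥ 0` of `osN_threshold_goodPivot_step` (`exists_pivot_helps_inside_ball`).
This discharges one half of the hypothesis of `osN_threshold_nonneg_of_goodPivots_det`; the other half (`Ψ ≥ 0` at the same pivot)
is the open GOOD-PIVOT LEMMA.
-/

noncomputable section

namespace Summit.CriticalPhenomena.PercolationContinuityZ3.Theorems

namespace SahiOneStep

open MeasureTheory Finset
open Literature.Probability.Percolation (DeterminedBy determinedBy_univ prodBernoulli_real_eq_sum_weight_ind)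
open Literature.Probability.LatticeModels (prodBernoulli)
open Literature.Probability.Percolation.DecisionTree (ind ind_of_mem ind_of_not_mem)
open Literature.Probability.Percolation.BHK2006 (weight ind_inter)
open scoped Classical

variable {ι : Type*} [Fintype ι]

/-! ## Double counting on a layer -/

omit [Fintype ι] in
/-- `Σ_{e ∈ F} 1[e ∈ ω] = N_F(ω)` as reals. [folklore] -/
theorem sum_ind_mem_eq_card (F : Finset ι) (ω : Set ι) :
    ∑ e ∈ F, ind {ω' : Set ι | e ∈ ω'} ω = ((F.filter (· ∈ ω)).card : ℝ) := by
  have h : ∀ e ∈ F, ind {ω' : Set ι | e ∈ ω'} ω = if e ∈ ω then (1 : ℝ) else 0 := fun e _ => by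
    by_cases he : e ∈ ω
    · rw [if_pos he]; exact ind_of_mem he
    · rw [if_neg he]; exact ind_of_not_mem he
  rw [Finset.sum_congr rfl h, Finset.sum_boole]

/-- **Double counting on a layer**: for `Y ⊆ {N_F = k}` (here `Y = X ∩ {N_F = k}`), `Σ_{e∈F} μ(Y ∩ {e ∈ ω}) = k·μ(Y)`. [folklore] -/
theorem sum_real_inter_mem_layer (p : ι → unitInterval) (F : Finset ι) (X : Set (Set ι)) (k : ℕ) :
    ∑ e ∈ F, (prodBernoulli p).real (X ∩ {ω : Set ι | (F.filter (· ∈ ω)).card = k} ∩ {ω : Set ι | e ∈ ω}) =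
      (k : ℝ) * (prodBernoulli p).real (X ∩ {ω : Set ι | (F.filter (· ∈ ω)).card = k}) := by
  simp_rw [prodBernoulli_real_eq_sum_weight_ind]
  rw [Finset.sum_comm, Finset.mul_sum]
  refine Finset.sum_congr rfl fun ω _ => ?_
  have h1 : ∀ e ∈ F, weight (fun i => (p i : ℝ)) ω * ind (X ∩ {ω' : Set ι | (F.filter (· ∈ ω')).card = k} ∩ {ω' : Set ι | e ∈ ω'}) ω =
      weight (fun i => (p i : ℝ)) ω * ind (X ∩ {ω' : Set ι | (F.filter (· ∈ ω')).card = k}) ω * ind {ω' : Set ι | e ∈ ω'} ω :=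
    fun e _ => by rw [ind_inter, mul_assoc]
  rw [Finset.sum_congr rfl h1, ← Finset.mul_sum, sum_ind_mem_eq_card]
  by_cases hω : ω ∈ X ∩ {ω' : Set ι | (F.filter (· ∈ ω')).card = k}
  · have hk : ((F.filter (· ∈ ω)).card : ℝ) = k := by exact_mod_cast hω.2
    rw [hk]; ring
  · rw [ind_of_not_mem hω]; ring

/-- `Σ_{e∈F} μ(X ∩ {N_F < s} ∩ {e ∈ ω}) = Σ_{k<s} k·μ(X ∩ {N_F = k})`. [folklore] -/
theorem sum_real_inter_ball_mem (p : ι → unitInterval) (F : Finset ι) (X : Set (Set ι)) (s : ℕ) :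
    ∑ e ∈ F, (prodBernoulli p).real (X ∩ {ω : Set ι | (F.filter (· ∈ ω)).card < s} ∩ {ω : Set ι | e ∈ ω}) =
      ∑ k ∈ range s, (k : ℝ) * (prodBernoulli p).real (X ∩ {ω : Set ι | (F.filter (· ∈ ω)).card = k}) := by
  have h : ∀ e ∈ F, (prodBernoulli p).real (X ∩ {ω : Set ι | (F.filter (· ∈ ω)).card < s} ∩ {ω : Set ι | e ∈ ω}) =
      ∑ k ∈ range s, (prodBernoulli p).real ((X ∩ {ω : Set ι | e ∈ ω}) ∩ {ω : Set ι | (F.filter (· ∈ ω)).card = k}) := by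
    intro e _
    rw [← real_inter_ball_eq_sum p F (X ∩ {ω : Set ι | e ∈ ω}) s, Set.inter_assoc, Set.inter_assoc, Set.inter_comm {ω : Set ι | e ∈ ω}]
  rw [Finset.sum_congr rfl h, Finset.sum_comm]
  refine Finset.sum_congr rfl fun k _ => ?_
  have h2 : ∀ e ∈ F, (prodBernoulli p).real ((X ∩ {ω : Set ι | e ∈ ω}) ∩ {ω : Set ι | (F.filter (· ∈ ω)).card = k}) =
      (prodBernoulli p).real (X ∩ {ω : Set ι | (F.filter (· ∈ ω)).card = k} ∩ {ω : Set ι | e ∈ ω}) := fun e _ => by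
    rw [Set.inter_assoc, Set.inter_comm {ω : Set ι | e ∈ ω}, ← Set.inter_assoc]
  rw [Finset.sum_congr rfl h2, sum_real_inter_mem_layer]

/-! ## `Cov_{ball}(1_B, N_F) ≥ 0` and the pivot lemma -/

/-- **`Cov_{μ(·∣N_F<s)}(1_B, N_F) ≥ 0` for an increasing `B`** (cross-multiplied): layer monotonicity + MLR comparison. [this work] -/
theorem ball_mul_sum_layer_le (p : ι → unitInterval) (F : Finset ι) {B : Set (Set ι)} (hB : IsUpperSet B) (s : ℕ) :
    (prodBernoulli p).real (B ∩ {ω : Set ι | (F.filter (· ∈ ω)).card < s}) *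
        ∑ k ∈ range s, (k : ℝ) * (prodBernoulli p).real {ω : Set ι | (F.filter (· ∈ ω)).card = k} ≤
      (prodBernoulli p).real {ω : Set ι | (F.filter (· ∈ ω)).card < s} *
        ∑ k ∈ range s, (k : ℝ) * (prodBernoulli p).real (B ∩ {ω : Set ι | (F.filter (· ∈ ω)).card = k}) := by
  set h : ℕ → ℝ := fun k => (prodBernoulli p).real {ω : Set ι | (F.filter (· ∈ ω)).card = k} with hh
  set h' : ℕ → ℝ := fun k => (prodBernoulli p).real (B ∩ {ω : Set ι | (F.filter (· ∈ ω)).card = k}) with hh'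
  have hmlr : ∀ i j, i ≤ j → h j * h' i ≤ h i * h' j := by
    intro i j hij
    simp only [hh, hh']
    have hm := real_inter_inter_layer_mul_le p F hB (determinedBy_univ ((↑F : Set ι)ᶜ)) hij
    rw [Set.inter_univ] at hm
    linarith [hm]
  have hφ : ∀ i j, i ≤ j → j < s → (h i ≠ 0 ∨ h' i ≠ 0) → (h j ≠ 0 ∨ h' j ≠ 0) → ((i : ℕ) : ℝ) ≤ (j : ℝ) :=
    fun i j hij _ _ _ => by exact_mod_cast hij
  have key := ThreshGrid.mlr_sum_le s h h' (fun k => (k : ℝ)) hmlr hφ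
  rw [real_inter_ball_eq_sum p F B s, real_ball_eq_sum p F s]
  have e1 : ∑ k ∈ range s, (k : ℝ) * (prodBernoulli p).real {ω : Set ι | (F.filter (· ∈ ω)).card = k} = ∑ k ∈ range s, h k * (k : ℝ) :=
    Finset.sum_congr rfl fun k _ => by simp only [hh]; ring
  have e2 : ∑ k ∈ range s, (k : ℝ) * (prodBernoulli p).real (B ∩ {ω : Set ι | (F.filter (· ∈ ω)).card = k}) =
      ∑ k ∈ range s, h' k * (k : ℝ) := Finset.sum_congr rfl fun k _ => by simp only [hh']; ring
  rw [e1, e2]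
  exact key

/-- **THE PIVOT LEMMA.**  For an increasing `B`, a nonempty block `F` whose densities lie in `(0,1)`, and a level `t`, there is a counted
pivot `e ∈ F` that helps `B` inside the ball: `μ{N_{F∖e} < t}·μ(B⁰ ∩ {N_{F∖e} < t+1}) ≤ μ{N_{F∖e} < t+1}·μ(B¹ ∩ {N_{F∖e} < t})`
(`B¹ ⊇ B⁰` the sections of `B` at `e`), i.e. `Cov_{μ(·∣N_F ≤ t)}(1_B, x_e) ≥ 0` — the first good-pivot condition of
`osN_threshold_goodPivot_step`. [this work] -/
theorem exists_pivot_helps_inside_ball (p : ι → unitInterval) {F : Finset ι} (hF : F.Nonempty)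
    (hp : ∀ i ∈ F, 0 < (p i : ℝ) ∧ (p i : ℝ) < 1) (t : ℕ) {B : Set (Set ι)} (hB : IsUpperSet B) :
    ∃ e ∈ F,
      (prodBernoulli p).real {ω : Set ι | ((F.erase e).filter (· ∈ ω)).card < t} *
          (prodBernoulli p).real ({ω : Set ι | ω \ {e} ∈ B} ∩ {ω : Set ι | ((F.erase e).filter (· ∈ ω)).card < t + 1}) ≤
        (prodBernoulli p).real {ω : Set ι | ((F.erase e).filter (· ∈ ω)).card < t + 1} *
          (prodBernoulli p).real ({ω : Set ι | insert e ω ∈ B} ∩ {ω : Set ι | ((F.erase e).filter (· ∈ ω)).card < t}) := by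
  set μ := prodBernoulli p with hμ
  set L : Set (Set ι) := {ω : Set ι | (F.filter (· ∈ ω)).card < t + 1} with hL
  -- the summed covariance is nonnegative
  have hsum : ∑ e ∈ F, (μ.real (B ∩ L) * μ.real (L ∩ {ω : Set ι | e ∈ ω})) ≤
      ∑ e ∈ F, (μ.real L * μ.real (B ∩ L ∩ {ω : Set ι | e ∈ ω})) := by
    rw [← Finset.mul_sum, ← Finset.mul_sum]
    have h1 := sum_real_inter_ball_mem p F Set.univ (t + 1)
    have h2 := sum_real_inter_ball_mem p F B (t + 1)
    simp only [Set.univ_inter] at h1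
    rw [h1, h2]
    exact ball_mul_sum_layer_le p F hB (t + 1)
  obtain ⟨e, heF, he⟩ := Finset.exists_le_of_sum_le hF hsum
  refine ⟨e, heF, ?_⟩
  -- rewrite everything through the sections at `e`
  have hFe : F = insert e (F.erase e) := (Finset.insert_erase heF).symm
  have heF' : e ∉ F.erase e := F.notMem_erase e
  set F' := F.erase e with hF'
  set L1 : Set (Set ι) := {ω : Set ι | (F'.filter (· ∈ ω)).card < t} with hL1
  set L0 : Set (Set ι) := {ω : Set ι | (F'.filter (· ∈ ω)).card < t + 1} with hL0
  set B1 : Set (Set ι) := {ω : Set ι | insert e ω ∈ B} with hB1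
  set B0 : Set (Set ι) := {ω : Set ι | ω \ {e} ∈ B} with hB0
  -- sections of `L` (as the complement of the threshold slot `{t+1 ≤ N_{insert e F'}}`)
  have hLH : L = {ω : Set ι | t + 1 ≤ ((insert e F').filter (· ∈ ω)).card}ᶜ := by
    ext ω; rw [← hFe]; simp only [hL, Set.mem_setOf_eq, Set.mem_compl_iff, not_le]
  have sL1 : {ω : Set ι | insert e ω ∈ L} = L1 := by
    have h := section_insert_threshold heF' t
    ext ω
    have hω := Set.ext_iff.1 h ω
    simp only [Set.mem_setOf_eq] at hω
    simp only [hLH, Set.mem_setOf_eq, Set.mem_compl_iff, not_le, hL1]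
    constructor
    · intro hlt; by_contra hge; exact absurd (hω.2 (not_lt.1 hge)) (not_le.2 hlt)
    · intro hlt; by_contra hge; exact absurd (hω.1 (not_lt.1 hge)) (not_le.2 hlt)
  have sL0 : {ω : Set ι | ω \ {e} ∈ L} = L0 := by
    have h := section_sdiff_threshold heF' t
    ext ω
    have hω := Set.ext_iff.1 h ω
    simp only [Set.mem_setOf_eq] at hω
    simp only [hLH, Set.mem_setOf_eq, Set.mem_compl_iff, not_le, hL0]
    constructor
    · intro hlt; by_contra hge; exact absurd (hω.2 (not_lt.1 hge)) (not_le.2 hlt)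
    · intro hlt; by_contra hge; exact absurd (hω.1 (not_lt.1 hge)) (not_le.2 hlt)
  -- splits along `e`
  have sIe : ∀ X : Set (Set ι), {ω : Set ι | insert e ω ∈ X ∩ {ω : Set ι | e ∈ ω}} = {ω : Set ι | insert e ω ∈ X} := fun X => by
    ext ω; simp only [Set.mem_setOf_eq, Set.mem_inter_iff, Set.mem_insert_iff, true_or, and_true]
  have sOe : ∀ X : Set (Set ι), {ω : Set ι | ω \ {e} ∈ X ∩ {ω : Set ι | e ∈ ω}} = ∅ := fun X => by
    ext ω; simp only [Set.mem_setOf_eq, Set.mem_inter_iff, Set.mem_sdiff_singleton, Set.mem_empty_iff_false, iff_false]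
    exact fun h => h.2.2 rfl
  have eLe : μ.real (L ∩ {ω : Set ι | e ∈ ω}) = (p e : ℝ) * μ.real L1 := by
    rw [real_split p e, sIe, sOe, sL1, measureReal_empty, mul_zero, add_zero]
  have eBLe : μ.real (B ∩ L ∩ {ω : Set ι | e ∈ ω}) = (p e : ℝ) * μ.real (B1 ∩ L1) := by
    rw [real_split p e, sIe, sOe, section_insert_inter, sL1, measureReal_empty, mul_zero, add_zero]
  have eL : μ.real L = (p e : ℝ) * μ.real L1 + (1 - p e) * μ.real L0 := by
    rw [real_split p e L, sL1, sL0]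
  have eBL : μ.real (B ∩ L) = (p e : ℝ) * μ.real (B1 ∩ L1) + (1 - p e) * μ.real (B0 ∩ L0) := by
    rw [real_split p e (B ∩ L), section_insert_inter, section_sdiff_inter, sL1, sL0]
  rw [eLe, eBLe, eL, eBL] at he
  -- he : (p μ(B1L1) + q μ(B0L0)) (p ℓ¹) ≤ (p ℓ¹ + q ℓ⁰) (p μ(B1L1))  ⟹  p q ℓ¹ μ(B0L0) ≤ p q ℓ⁰ μ(B1L1)
  have hpe : 0 < (p e : ℝ) := (hp e heF).1
  have hqe : 0 < 1 - (p e : ℝ) := by linarith [(hp e heF).2]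
  have hpq : 0 < (p e : ℝ) * (1 - p e) := mul_pos hpe hqe
  have key : (p e : ℝ) * (1 - p e) * (μ.real L1 * μ.real (B0 ∩ L0)) ≤
      (p e : ℝ) * (1 - p e) * (μ.real L0 * μ.real (B1 ∩ L1)) := by nlinarith [he]
  exact le_of_mul_le_mul_left key hpq

end SahiOneStep

end Summit.CriticalPhenomena.PercolationContinuityZ3.Theorems
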